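import Literature.NumberTheory.Congruences.JacobsthalBlockCongruence
import Mathlib.NumberTheory.Padics.PadicVal.Basic
import Mathlib.Data.Nat.Factorization.Basic
import Mathlib.Data.Nat.Choose.Basic
import Mathlib.Tactic
import HarnessLib

/-!
# The block polynomial `E_c(x) = ∏_{0<i<cp, p∤i} (px + i)`: `E_c(x) − E_c(0) ∈ p^{3+v_p(c)} x (x + c) ℤ[x]` (`p ≥ 5`)

Topic `Literature/NumberTheory/Congruences`, namespace `Literature.NumberTheory.Congruences.Jacobsthal`;
the sequel of `JacobsthalBlockCongruence.lean` (which holds the sources, quoted verbatim, and the route)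
and the input of `JacobsthalBinomialCongruence.lean`. Everything here is PROVED (theorems only; no
definitions, no named facts). HONEST FRAMING (cell pub-zeta5, D2 lens): a `p`-adic polynomial congruence;
nothing about `ζ(5)`.

The set `{0 < i < cp : p ∤ i}` is parametrised by blocks, `i = kp + j` with `k < c`, `0 < j < p`, so that
`E_c(x) = ∏_{k<c} ∏_{j ∈ Icc 1 (p−1)} (px + (kp + j))` (double `Finset` products throughout; no new
definition is introduced).

* `prod_coprime_pow_succ_eq` — `t(p^{s+1}) = {kp + j : k < p^s, 0 < j < p}`: the one-block congruence of
  the previous file reads `E_{p^s}(x) ≡ E_{p^s}(0) (mod p^{s+3} ℤ[x])`.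
* `exists_map_blocks_eq_C`, `C_dvd_blocks_sub_C` — TRANSLATION: for `c = p^s u` the blocks
  `k ∈ [wp^s, (w+1)p^s)` give `E_{p^s}(x + wp^s)`, so `E_{p^s u}(x) ≡ E_{p^s u}(0) (mod p^{s+3} ℤ[x])`.
* `eval_neg_blocks` — REFLECTION `i ↦ cp − i`: `E_c(−c) = E_c(0)` (`p` odd, so `#{…}= c(p−1)` is even).
* **`exists_blocks_eq`** — hence `E_c(x) − E_c(0)` has the roots `0` and `−c` and is divisible by
  `p^{3+v_p(c)}` coefficientwise; since `x(x + c)` is monic (a non-zero-divisor modulo `p^{3+v_p(c)}`),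
  `E_c(x) = E_c(0) + p^{3+v_p(c)} · x (x + c) · H(x)` with `H ∈ ℤ[x]`. Equivalently, for the rational
  function of Jacobsthal's quotient, `∏_{0<i<cp, p∤i} (1 + px/i) − 1 ∈ p^{3+v_p(c)} x(x+c) ℤ_{(p)}[x]`.

Desk check (this seat, exact arithmetic, outside Lean): the exponent `3 + v_p(c)` is attained (not
exceeded) by the content of `(E_c(x) − E_c(0))/(x(x+c))` for every `p ∈ {5, 7, 11}`, `c ≤ 25`.

References: as in `JacobsthalBlockCongruence.lean` ([Mestrovic2011] §6 (34)–(36); [Straub2014] Lemma 5.1;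
[HardyWright2008] Thms 126, 128).
-/

noncomputable section

open Polynomial Finset
open scoped Nat

namespace Literature.NumberTheory.Congruences.Jacobsthal

section Blocks

variable {p : ℕ} [hp : Fact p.Prime]

omit hp in
/-- Reduction modulo `n` kills an integer polynomial iff `n` divides it coefficientwise, i.e. iff
`C n ∣ P`. [folklore] -/
private theorem map_eq_zero_iff_C_dvd (n : ℕ) (P : ℤ[X]) :
    P.map (Int.castRingHom (ZMod n)) = 0 ↔ C (n : ℤ) ∣ P := by
  rw [C_dvd_iff_dvd_coeff, Polynomial.ext_iff]
  refine forall_congr' fun i => ?_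
  rw [coeff_map, coeff_zero, eq_intCast, ZMod.intCast_zmod_eq_zero_iff_dvd]

omit hp in
/-- If `X (X + c) H` is coefficientwise divisible by `n`, so is `H` (the quadratic is monic). [folklore] -/
private theorem C_dvd_of_C_dvd_X_mul (n : ℕ) (c : ℤ) (H : ℤ[X]) (h : C (n : ℤ) ∣ X * (X + C c) * H) :
    C (n : ℤ) ∣ H := by
  rw [← map_eq_zero_iff_C_dvd] at h ⊢
  rw [Polynomial.map_mul, Polynomial.map_mul, map_X, Polynomial.map_add, map_X, map_C] at h
  have hmon : ((X : (ZMod n)[X]) * (X + C ((Int.castRingHom (ZMod n)) c))).Monic :=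
    monic_X.mul (monic_X_add_C _)
  exact hmon.mul_right_eq_zero_iff.mp h



omit hp in
/-- Reflection of the inner block: `∏_{0<i<p} g(p − i) = ∏_{0<i<p} g(i)`. [folklore] -/
private theorem prod_Icc_reflect {M : Type*} [CommMonoid M] (g : ℕ → M) :
    ∏ i ∈ Icc 1 (p - 1), g (p - i) = ∏ i ∈ Icc 1 (p - 1), g i := by
  refine prod_nbij' (fun i => p - i) (fun i => p - i) (fun i hi => ?_) (fun i hi => ?_)
    (fun i hi => ?_) (fun i hi => ?_) (fun i _ => rfl)
  all_goals simp only [mem_Icc] at hi ⊢; omega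

/-- **The reduced residues modulo `p^{s+1}` by their last digit**: `t(p^{s+1})` is the set of the
numbers `k p + i` with `k < p^s` and `0 < i < p`, so that a product over `t(p^{s+1})` is a double product
over blocks. [folklore] -/
private theorem prod_coprime_pow_succ_eq {M : Type*} [CommMonoid M] (s : ℕ) (g : ℕ → M) :
    ∏ t ∈ {t ∈ range (p ^ (s + 1)) | (p ^ (s + 1)).Coprime t}, g t =
      ∏ k ∈ range (p ^ s), ∏ i ∈ Icc 1 (p - 1), g (k * p + i) := by
  have hp' := hp.out
  have hset : {t ∈ range (p ^ (s + 1)) | (p ^ (s + 1)).Coprime t} =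
      (range (p ^ s) ×ˢ Icc 1 (p - 1)).image (fun q : ℕ × ℕ => q.1 * p + q.2) := by
    ext t
    simp only [mem_filter, mem_range, mem_image, mem_product, mem_Icc, Prod.exists,
      Nat.coprime_pow_left_iff (Nat.succ_pos s), hp'.coprime_iff_not_dvd]
    constructor
    · rintro ⟨ht, hndvd⟩
      refine ⟨t / p, t % p, ⟨?_, ?_, ?_⟩, Nat.div_add_mod' t p⟩
      · exact (Nat.div_lt_iff_lt_mul hp'.pos).mpr (by rwa [← pow_succ])
      · exact Nat.one_le_iff_ne_zero.mpr fun h => hndvd (Nat.dvd_of_mod_eq_zero h)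
      · have := Nat.mod_lt t hp'.pos; omega
    · rintro ⟨k, i, ⟨hk, hi1, hi2⟩, rfl⟩
      refine ⟨?_, fun h => ?_⟩
      · have h1 : k * p + p ≤ p ^ s * p := by
          have := Nat.mul_le_mul_right p hk
          rwa [Nat.succ_mul] at this
        rw [pow_succ]; omega
      · have hi : p ∣ i := (Nat.dvd_add_right (dvd_mul_left p k)).mp h
        have := Nat.le_of_dvd (by omega) hi
        omega
  have hinj : Set.InjOn (fun q : ℕ × ℕ => q.1 * p + q.2) ↑(range (p ^ s) ×ˢ Icc 1 (p - 1)) := by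
    rintro ⟨k, i⟩ hq ⟨k', i'⟩ hq' h
    simp only [coe_product, Set.mem_prod, mem_coe, mem_range, mem_Icc] at hq hq'
    simp only at h
    have hi : i = i' := by
      have h1 := congrArg (· % p) h
      simp only [Nat.mul_add_mod_of_lt (show i < p by omega),
        Nat.mul_add_mod_of_lt (show i' < p by omega)] at h1
      exact h1
    subst hi
    have hk : k * p = k' * p := by omega
    exact Prod.ext (Nat.eq_of_mul_eq_mul_right hp'.pos hk) rfl
  rw [hset, prod_image hinj, prod_product]

omit hp in
/-- The constant term of a block product: `(∏_{k<c} ∏_{0<i<p} (p x + (k p + i)))(0) = ∏∏ (k p + i)`.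
[folklore] -/
private theorem eval_zero_blocks (c : ℕ) :
    (∏ k ∈ range c, ∏ i ∈ Icc 1 (p - 1), (C (p : ℤ) * X + C ((k * p + i : ℕ) : ℤ))).eval 0 =
      ∏ k ∈ range c, ∏ i ∈ Icc 1 (p - 1), ((k * p + i : ℕ) : ℤ) := by
  rw [eval_prod]
  refine prod_congr rfl fun k _ => ?_
  rw [eval_prod]
  refine prod_congr rfl fun i _ => ?_
  simp

/-- **The reflection `i ↦ cp − i`** of `{0 < i < cp : p ∤ i}`: the block product takes the same value at
`x = −c` as at `x = 0`, `∏_{k<c} ∏_{0<i<p} (−c p + k p + i) = ∏∏ (k p + i)` (`p` odd).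
[folklore] -/
private theorem eval_neg_blocks (hp2 : p ≠ 2) (c : ℕ) :
    (∏ k ∈ range c, ∏ i ∈ Icc 1 (p - 1), (C (p : ℤ) * X + C ((k * p + i : ℕ) : ℤ))).eval (-(c : ℤ)) =
      ∏ k ∈ range c, ∏ i ∈ Icc 1 (p - 1), ((k * p + i : ℕ) : ℤ) := by
  have hp' := hp.out
  have hev : Even (p - 1) := hp'.even_sub_one hp2
  rw [eval_prod]
  -- each block at `−c` is minus a reflected block, and the sign `(−1)^{p−1}` is `1`
  have hblock : ∀ k ∈ range c,
      (∏ i ∈ Icc 1 (p - 1), (C (p : ℤ) * X + C ((k * p + i : ℕ) : ℤ))).eval (-(c : ℤ)) =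
        ∏ i ∈ Icc 1 (p - 1), (((c - 1 - k) * p + (p - i) : ℕ) : ℤ) := by
    intro k hk
    have hk' := mem_range.mp hk
    have hterm : ∀ i ∈ Icc 1 (p - 1), (C (p : ℤ) * X + C ((k * p + i : ℕ) : ℤ)).eval (-(c : ℤ)) =
        (-1) * (((c - 1 - k) * p + (p - i) : ℕ) : ℤ) := by
      intro i hi
      have hi' := mem_Icc.mp hi
      have e1 : ((c - 1 - k : ℕ) : ℤ) = (c : ℤ) - 1 - k := by
        rw [Nat.cast_sub (by omega : k ≤ c - 1), Nat.cast_sub (by omega : 1 ≤ c), Nat.cast_one]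
      have e2 : ((p - i : ℕ) : ℤ) = (p : ℤ) - i := by rw [Nat.cast_sub (by omega : i ≤ p)]
      simp only [eval_add, eval_mul, eval_C, eval_X, Nat.cast_add, Nat.cast_mul, e1, e2]
      ring
    rw [eval_prod, prod_congr rfl hterm, prod_mul_distrib, prod_const, Nat.card_Icc,
      show p - 1 + 1 - 1 = p - 1 by omega, hev.neg_one_pow, one_mul]
  rw [prod_congr rfl hblock]
  have hrefl := prod_range_reflect (fun k' => ∏ i ∈ Icc 1 (p - 1), ((k' * p + (p - i) : ℕ) : ℤ)) c
  rw [hrefl]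
  refine prod_congr rfl fun k _ => ?_
  exact prod_Icc_reflect (fun i => ((k * p + i : ℕ) : ℤ))

/-- **Several blocks modulo `p^{s+3}`**: for `p > 3`, the reduction of
`∏_{k < p^s u} ∏_{0<i<p} (p x + (k p + i))` modulo `p^{s+3}` is a constant polynomial (the `u`
translates `x ↦ x + w p^s`, `w < u`, of the one-block congruence). [folklore] -/
private theorem exists_map_blocks_eq_C (h3 : 3 < p) (s u : ℕ) :
    ∃ c₀ : ZMod (p ^ (s + 3)), (∏ k ∈ range (p ^ s * u), ∏ i ∈ Icc 1 (p - 1),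
      (C (p : ℤ) * X + C ((k * p + i : ℕ) : ℤ))).map (Int.castRingHom (ZMod (p ^ (s + 3)))) = C c₀ := by
  -- one block
  obtain ⟨H, hH⟩ := exists_prod_C_mul_X_add_C_eq (p := p) h3 (a := s + 1) (by omega)
  rw [prod_coprime_pow_succ_eq, prod_coprime_pow_succ_eq] at hH
  set B : ℤ[X] := ∏ k ∈ range (p ^ s), ∏ i ∈ Icc 1 (p - 1), (C (p : ℤ) * X + C ((k * p + i : ℕ) : ℤ))
    with hB
  set ψ := Int.castRingHom (ZMod (p ^ (s + 3))) with hψ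
  have hBmap : B.map ψ = C (ψ (∏ k ∈ range (p ^ s), ∏ i ∈ Icc 1 (p - 1), ((k * p + i : ℕ) : ℤ))) := by
    have h0 : ψ ((p : ℤ) ^ (s + 1 + 2)) = 0 := by
      rw [map_pow, map_natCast, show s + 1 + 2 = s + 3 by ring, ← Nat.cast_pow, ZMod.natCast_self]
    rw [hH, Polynomial.map_add, Polynomial.map_mul, map_C, map_C, h0, C_0, zero_mul, add_zero]
  induction u with
  | zero => exact ⟨1, by simp⟩
  | succ u ih =>
    obtain ⟨c₀, hc₀⟩ := ih
    refine ⟨c₀ * ψ (∏ k ∈ range (p ^ s), ∏ i ∈ Icc 1 (p - 1), ((k * p + i : ℕ) : ℤ)), ?_⟩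
    rw [Nat.mul_succ, prod_range_add, Polynomial.map_mul, hc₀, C_mul]
    congr 1
    -- the new block is the first block translated by `u p^s`
    have hshift : ∏ k ∈ range (p ^ s), ∏ i ∈ Icc 1 (p - 1),
        (C (p : ℤ) * X + C (((p ^ s * u + k) * p + i : ℕ) : ℤ)) = B.comp (X + C ((p ^ s * u : ℕ) : ℤ)) := by
      rw [hB, Polynomial.prod_comp]
      refine prod_congr rfl fun k _ => ?_
      rw [Polynomial.prod_comp]
      refine prod_congr rfl fun i _ => ?_
      rw [add_comp, mul_comp, C_comp, X_comp, C_comp]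
      simp only [Nat.cast_add, Nat.cast_mul, Nat.cast_pow, C_add, C_mul, C_pow]
      ring
    rw [hshift, Polynomial.map_comp, hBmap, C_comp]

/-- The same, pulled back to `ℤ[x]`: `p^{s+3}` divides `∏_{k < p^s u} ∏_{0<i<p} (p x + (k p + i))`
minus its constant term, coefficientwise. [folklore] -/
private theorem C_dvd_blocks_sub_C (h3 : 3 < p) (s u : ℕ) :
    C ((p : ℤ) ^ (s + 3)) ∣ ∏ k ∈ range (p ^ s * u), ∏ i ∈ Icc 1 (p - 1),
        (C (p : ℤ) * X + C ((k * p + i : ℕ) : ℤ)) -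
      C (∏ k ∈ range (p ^ s * u), ∏ i ∈ Icc 1 (p - 1), ((k * p + i : ℕ) : ℤ)) := by
  obtain ⟨c₀, hc₀⟩ := exists_map_blocks_eq_C (p := p) h3 s u
  have h := map_eq_zero_iff_C_dvd (p ^ (s + 3)) (∏ k ∈ range (p ^ s * u), ∏ i ∈ Icc 1 (p - 1),
        (C (p : ℤ) * X + C ((k * p + i : ℕ) : ℤ)) -
      C (∏ k ∈ range (p ^ s * u), ∏ i ∈ Icc 1 (p - 1), ((k * p + i : ℕ) : ℤ)))
  rw [Nat.cast_pow] at h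
  rw [← h, Polynomial.map_sub, hc₀, map_C, ← eval_zero_blocks, ← coeff_zero_eq_eval_zero, sub_eq_zero,
    ← coeff_map, hc₀, coeff_C_zero]

/-- **The block polynomial congruence with its two roots.** For a prime `p ≥ 5` and `c ≥ 0`, with
`s = v_p(c)`: `∏_{k<c} ∏_{0<i<p} (p x + k p + i) = ∏∏ (k p + i) + p^{s+3} · x (x + c) · H(x)` for an integer
polynomial `H` — i.e. `∏_{0<i<cp, p∤i} (1 + p x/i) − 1 ∈ p^{3+v_p(c)} x (x + c) ℤ_{(p)}[x]`. This polynomial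
form is THIS FILE's (not in print); evaluated at `x = b` it is Jacobsthal's congruence (34) in the ratio form
(41), which is what it is cited for. [cite: Mestrovic2011, §6 (34) (polynomial mechanism; this form not in print)]
[cite: Straub2014, Lemma 5.1 (41)] -/
theorem exists_blocks_eq (h3 : 3 < p) (c : ℕ) :
    ∃ H : ℤ[X], ∏ k ∈ range c, ∏ i ∈ Icc 1 (p - 1), (C (p : ℤ) * X + C ((k * p + i : ℕ) : ℤ)) =
      C (∏ k ∈ range c, ∏ i ∈ Icc 1 (p - 1), ((k * p + i : ℕ) : ℤ)) +
        C ((p : ℤ) ^ (padicValNat p c + 3)) * X * (X + C (c : ℤ)) * H := by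
  have hp' := hp.out
  rcases Nat.eq_zero_or_pos c with h0 | hc
  · subst h0; exact ⟨0, by simp⟩
  set s := padicValNat p c with hs
  set E : ℤ[X] := ∏ k ∈ range c, ∏ i ∈ Icc 1 (p - 1), (C (p : ℤ) * X + C ((k * p + i : ℕ) : ℤ)) with hE
  set Q : ℤ := ∏ k ∈ range c, ∏ i ∈ Icc 1 (p - 1), ((k * p + i : ℕ) : ℤ) with hQ
  -- `c = p^s u`
  have hcu : p ^ s * (c / p ^ s) = c := Nat.mul_div_cancel' pow_padicValNat_dvd
  have hdvd : C ((p : ℤ) ^ (s + 3)) ∣ E - C Q := by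
    have h := C_dvd_blocks_sub_C (p := p) h3 s (c / p ^ s)
    rwa [hcu] at h
  -- the roots `0` and `−c`
  have hroot0 : (E - C Q).eval 0 = 0 := by rw [eval_sub, eval_C, hE, eval_zero_blocks, sub_self]
  have hrootc : (E - C Q).eval (-(c : ℤ)) = 0 := by
    rw [eval_sub, eval_C, hE, eval_neg_blocks (p := p) (by omega), sub_self]
  obtain ⟨G, hG⟩ : X ∣ E - C Q := by rw [X_dvd_iff, coeff_zero_eq_eval_zero, hroot0]
  have hGc : G.IsRoot (-(c : ℤ)) := by
    have h := hrootc
    rw [hG, eval_mul, eval_X, mul_eq_zero] at h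
    rcases h with h | h
    · exfalso; have : (c : ℤ) ≠ 0 := by exact_mod_cast hc.ne'
      exact this (neg_eq_zero.mp h)
    · exact h
  obtain ⟨H₁, hH₁⟩ := dvd_iff_isRoot.mpr hGc
  rw [C_neg, sub_neg_eq_add] at hH₁
  rw [hH₁, ← mul_assoc] at hG
  -- `p^{s+3} ∣ x (x + c) H₁` coefficientwise, hence `p^{s+3} ∣ H₁`
  rw [hG] at hdvd
  obtain ⟨H, hH⟩ := C_dvd_of_C_dvd_X_mul (p ^ (s + 3)) (c : ℤ) H₁ (by exact_mod_cast hdvd)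
  refine ⟨H, ?_⟩
  rw [← sub_eq_iff_eq_add', hG, hH]
  push_cast
  ring

end Blocks

end Literature.NumberTheory.Congruences.Jacobsthal

end
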